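import Summits.BirchSwinnertonDyer.Rank1Residual.GaloisImage.ElkiesModNineImageOfNoTower
import Summits.BirchSwinnertonDyer.Rank1Residual.Additive.TypeGThreeTowerOfSurj
import HarnessLib

/-!
# The X4 end-state at `3` with the EXOTIC piece NAMED: `j ∈ f(ℙ¹(ℚ))` (Elkies' family) replaces
# "the `3`-adic tower fails" — modulo the ONE cited moduli sentence
# (cell `b2b-bsdres`, team n1011, seat p10 gen 7 — row T-b11-ELK FILE 1e, class side; over FILE 1d
# `ElkiesModNineImageOfNoTower` and n1011-p14's end-state `x4SharpUnitFree_iff_lower_and_residues_sharp_exoticTypeG_noL20`)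

HONEST FRAMING (cell `b2b-bsdres`, run/shared/lean/b2b/bsd-rank1-residual/, verbatim in every
file): the goal of the cell is to DELETE the COMBINATION-SHAPED residual classes of the
Birch–Swinnerton-Dyer formula for ALL analytic-rank `≤ 1` elliptic curves over `ℚ` — "full BSD
formula for every rank `≤ 1` curve in class `C`" assembled STRICTLY from published theorems — so
that the rank-`≤ 1` remainder becomes exactly the CONSTRUCTION-SHAPED classes, which are TYPED
(missing-input `Prop`s), NOT attempted. This is not "finishing BSD". Team n1011 (N10 / N11):
research route; no claim beyond the stated classes; labels UNCHANGED; nothing is booked. Theorems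
only (no definition, no named fact). CONDITIONAL on the ONE cited named fact
`Elkies2006.modNineImage_conj_elkiesGroup_iff_j ℚ` (binder `hElk`; p281678) wherever `j ∈ f(ℙ¹(ℚ))`
appears; the eight inputs of p14's end-state keep their binders verbatim.

## What this file proves

* **`exotic_iff_exotic_of_elkies (hElk)`** — p14's EXOTIC piece of the X4 end-state at `3`
  ("`r_an = 0`, X4, surj(3), `ord₃ j ≥ 0`, `¬ TypeG W 3`, tower FAILS ⟹ `MissingUpperBoundAt W 3`")
  is EQUIVALENT to the piece "`r_an = 0`, X4, surj(3), `j ∈ f(ℙ¹(ℚ))` ⟹ `MissingUpperBoundAt W 3`":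
  under surj(3) the tower fails iff `j ∈ f(ℙ¹(ℚ))` (FILE 1d
  `not_towerSurj_three_iff_j_mem_elkiesJSet_of_surj`), and on X4@3 a failing tower forces `ord₃ j ≥ 0`
  and `¬ TypeG` (p14's `ClassX4.towerSurj_three_of_surj_of_typeG_or_potMult`, contraposed).
* **`x4SharpUnitFree_iff_lower_and_residues_sharp_exoticElkies_noL20 (8 facts) (hElk)`** — the X4
  end-state of p251574 / p268581 with its EXOTIC piece quantified over `j ∈ f(ℙ¹(ℚ))` and NO tower
  hypothesis: the EXOTIC sub-universe of RESIDUAL-MAP §I N11 / O8 is, in the kernel and modulo `hElk`,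
  the explicitly parametrised thin set of [Elkies2006] — a NAMED construction-shaped piece
  (`MissingUpperBoundAt W 3` on it stays the missing input). Nothing booked; X4 CONSTRUCTION-SHAPED.

References: [Elkies2006] §§0–3; [SutherlandZywina2017] Prop. 2.7; [Wuthrich2014] Lemma 20;
[Kato2004Asterisque] Thm. 14.5 (3), (12.5.2); [SerreAbelianLadic1968] IV-23.
-/

noncomputable section

open scoped Classical

open WeierstrassCurve Literature.NumberTheory.EllipticCurves
  Literature.NumberTheory.EllipticCurves.ModularForms
  Literature.NumberTheory.EllipticCurves.Rank1Residual
  Literature.NumberTheory.EllipticCurves.Rank1Residual.Typed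
  Literature.NumberTheory.EllipticCurves.Elkies2006
  Summit.BirchSwinnertonDyer.Rank1Residual.GaloisImage

namespace Summit.BirchSwinnertonDyer.Rank1Residual.Additive

/-- **The EXOTIC piece of the X4 end-state at `3`, NAMED** (modulo the cited moduli sentence `hElk`):
"tower fails (with `ord₃ j ≥ 0`, `¬ TypeG`)" ⟺ "`j ∈ f(ℙ¹(ℚ))`" as hypotheses of the missing upper
bound on rank-`0` X4@3 rows with surj(3). [cite: Elkies2006, §§0–3] [cite: SutherlandZywina2017, Prop. 2.7]
[cite: Wuthrich2014, Lemma 20 (p. 399)] -/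
theorem exotic_iff_exotic_of_elkies (hElk : modNineImage_conj_elkiesGroup_iff_j ℚ) :
    (∀ (W : WeierstrassCurve ℚ) [W.IsElliptic] [W.IsGloballyMinimal],
        W.analyticRank = 0 → ClassX4 W 3 → Surj W 3 → 0 ≤ padicValRat 3 W.j → ¬ TypeG W 3 →
        ¬ (∀ n : ℕ, W.HasSurjectiveModNGaloisRep (3 ^ n : ℕ)) → MissingUpperBoundAt W 3) ↔
    (∀ (W : WeierstrassCurve ℚ) [W.IsElliptic] [W.IsGloballyMinimal],
        W.analyticRank = 0 → ClassX4 W 3 → Surj W 3 → W.j ∈ elkiesJSet ℚ →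
        MissingUpperBoundAt W 3) := by
  haveI : Fact (Nat.Prime 3) := ⟨Nat.prime_three⟩
  constructor
  · intro h W _ _ hr hX hsurj hj
    have hnot : ¬ ∀ n : ℕ, W.HasSurjectiveModNGaloisRep (3 ^ n : ℕ) :=
      (not_towerSurj_three_iff_j_mem_elkiesJSet_of_surj hElk W hsurj).2 hj
    have hGM : ¬ (TypeG W 3 ∨ padicValRat 3 W.j < 0) := fun hGM =>
      hnot (ClassX4.towerSurj_three_of_surj_of_typeG_or_potMult hX hGM hsurj)
    exact h W hr hX hsurj (le_of_not_gt fun hlt => hGM (Or.inr hlt)) (fun hG => hGM (Or.inl hG)) hnot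
  · intro h W _ _ hr hX hsurj _ _ hnot
    exact h W hr hX hsurj ((not_towerSurj_three_iff_j_mem_elkiesJSet_of_surj hElk W hsurj).1 hnot)

/-- **The X4 end-state at `3` with the EXOTIC piece NAMED** (p14's
`x4SharpUnitFree_iff_lower_and_residues_sharp_exoticTypeG_noL20` with its second conjunct rewritten by
`exotic_iff_exotic_of_elkies`): `X4SharpUnitFree` ⟺ LOWER ∧ (UPPER on the rank-`0` X4@3 surj(3) rows with
`j ∈ f(ℙ¹(ℚ))`) ∧ the three standing (G)/(M) pieces — the eight named inputs and `hElk` as binders,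
nothing discharged, nothing booked. [cite: Elkies2006, §§0–3] [cite: SutherlandZywina2017, Prop. 2.7]
[cite: Kato2004Asterisque, Thm. 14.5 (3) (p. 236)] [cite: Wuthrich2014, Lemma 20 (p. 399)] -/
theorem x4SharpUnitFree_iff_lower_and_residues_sharp_exoticElkies_noL20
    (hCT : exists_casselsTate_pairing (K := ℚ))
    (hKatoS : Kato2004.rankZero_padicValNat_sha_le_sub_localTamagawa_of_additive_potGood_of_imageContainsSL2)
    (hDel : Delbourgo1998.prop4_rankZero_pow_dvd_constantCoeff)
    (hGZK : rank_eq_analyticRank_of_analyticRank_le_one) (hmod : hasEntireLFunction_rat)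
    (hmodD : nonempty_modularParametrizationData)
    (hKatoχ : Wuthrich2014.kato_halfEigenCharIdeal_dvd_cyclotomicPrime_of_surjective)
    (hK : Kato2004.charIdeal_dvd_padicLFunctionBranch_component_of_surjective)
    (hElk : modNineImage_conj_elkiesGroup_iff_j ℚ) :
    X4SharpUnitFree ↔
      (∀ (W : WeierstrassCurve ℚ) [W.IsElliptic] [W.IsGloballyMinimal] (p : ℕ) [Fact p.Prime],
          W.analyticRank = 0 → ClassX4 W p → Surj W p → MissingLowerBoundAt W p) ∧
      (∀ (W : WeierstrassCurve ℚ) [W.IsElliptic] [W.IsGloballyMinimal],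
          W.analyticRank = 0 → ClassX4 W 3 → Surj W 3 → W.j ∈ elkiesJSet ℚ →
          MissingUpperBoundAt W 3) ∧
      (∀ (W : WeierstrassCurve ℚ) [W.IsElliptic] [W.IsGloballyMinimal] (p : ℕ) [Fact p.Prime],
          W.analyticRank = 0 → ClassX4 W p → Surj W p → 0 ≤ padicValRat p W.j →
          ¬ (TypeGOrd W p ∧ semistabilityIndex W p = 2) →
          padicValNat p ((W.baseChange ℚ_[p]).localTamagawaNumber ℤ_[p]) + 2 ≤
            padicValNat p W.tamagawaProduct →
          MissingUpperBoundAt W p) ∧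
      (∀ (W : WeierstrassCurve ℚ) [W.IsElliptic] [W.IsGloballyMinimal] (p : ℕ) [Fact p.Prime],
          W.analyticRank = 0 → ClassX4 W p → Surj W p → 0 ≤ padicValRat p W.j →
          ¬ (TypeGOrd W p ∧ semistabilityIndex W p = 2) →
          (∃ q : ℚ, shaAn W = (q : ℂ) ∧ Odd (padicValRat p q)) → MissingUpperBoundAt W p) ∧
      (∀ (W : WeierstrassCurve ℚ) [W.IsElliptic] [W.IsGloballyMinimal] (p : ℕ) [Fact p.Prime],
          W.analyticRank = 0 → ClassX4 W p → Surj W p → 0 ≤ padicValRat p W.j →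
          ¬ (TypeGOrd W p ∧ semistabilityIndex W p = 2) →
          (∀ (N : ℕ) [NeZero N] (D : ModularParametrizationData W N), (p : ℤ) ∣ D.maninConstant) →
          MissingUpperBoundAt W p) := by
  rw [x4SharpUnitFree_iff_lower_and_residues_sharp_exoticTypeG_noL20 hCT hKatoS hDel hGZK hmod hmodD
    hKatoχ hK, exotic_iff_exotic_of_elkies hElk]

end Summit.BirchSwinnertonDyer.Rank1Residual.Additive

end
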